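import Summits.Parity.BatemanHorn.Theorems.AlmostPrimeZerosSystemMomentDeficitAssemblyAlgebra
import Literature.NumberTheory.LFunctions.MertensElementary

/-!
# Crux `SystemMomentDeficit` (stmt-Parity-11326), line `Ideator3Sketch`: K1 from the rough-class deficit (auxiliaries)

Three self-contained pieces of the bridge RCD → K1
(`decorrelatedCovarianceBound_of_roughClassDeficit`, next file):

* `weightedCov_expand` — `Cov(Σ_q w_q Σ_i Z_{i,q}, N) = Σ_q w_q Σ_i Cov(Z_{i,q}, N)` (finite algebra);
* `sum_PP_vonMangoldt_div_le` — `Σ_{q ∈ PP(y)} Λ(q)/q ≤ 2 log y + 2` (Mertens' first theorem, upper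
  half, plus `Σ_p 1/p² ≤ 1`);
* `weightedTerm_ge` — the termwise real inequality: with `w = 1 − 2Λ/L ∈ [−1, 1]`,
  `−(A t) ≤ c ≤ U`, `0 ≤ U`, `U · (2Λ/L) ≤ B t`, one has `w c ≥ −(A t + B t)`.

Notation (docstrings only).  `PP(z)` = primes `≤ z` ∪ prime squares `≤ z`.  Everything is [folklore].
-/

namespace Summit.Parity.BatemanHorn.Cruxes.SystemMomentDeficit.Ideator3Sketch

open scoped BigOperators
open Finset

/-- Expansion of the covariance of a weighted sum of indicator families against `N`:
`Cov(Σ_q w_q Σ_i Z_{i,q}, N) = Σ_q w_q Σ_i Cov(Z_{i,q}, N)` (means over `R` with divisor `Y`).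
[folklore] -/
theorem weightedCov_expand {ι κ : Type*} (I : Finset ι) (S : Finset κ) (R : Finset ℕ)
    (w : κ → ℝ) (Z : ι → κ → ℕ → ℝ) (N : ℕ → ℝ) (Y : ℝ) :
    (∑ n ∈ R, (∑ q ∈ S, w q * ∑ i ∈ I, Z i q n) * N n) / Y -
        (∑ n ∈ R, ∑ q ∈ S, w q * ∑ i ∈ I, Z i q n) / Y * ((∑ n ∈ R, N n) / Y) =
      ∑ q ∈ S, w q * ∑ i ∈ I,
        ((∑ n ∈ R, Z i q n * N n) / Y - (∑ n ∈ R, Z i q n) / Y * ((∑ n ∈ R, N n) / Y)) := by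
  have h1 : ∑ n ∈ R, (∑ q ∈ S, w q * ∑ i ∈ I, Z i q n) * N n =
      ∑ q ∈ S, w q * ∑ i ∈ I, ∑ n ∈ R, Z i q n * N n := by
    calc ∑ n ∈ R, (∑ q ∈ S, w q * ∑ i ∈ I, Z i q n) * N n
        = ∑ n ∈ R, ∑ q ∈ S, ∑ i ∈ I, w q * (Z i q n * N n) := by
          refine sum_congr rfl fun n _ => ?_
          rw [sum_mul]
          refine sum_congr rfl fun q _ => ?_
          rw [mul_sum, sum_mul]
          exact sum_congr rfl fun i _ => by ring
      _ = ∑ q ∈ S, ∑ n ∈ R, ∑ i ∈ I, w q * (Z i q n * N n) := sum_comm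
      _ = ∑ q ∈ S, ∑ i ∈ I, ∑ n ∈ R, w q * (Z i q n * N n) :=
          sum_congr rfl fun q _ => sum_comm
      _ = ∑ q ∈ S, w q * ∑ i ∈ I, ∑ n ∈ R, Z i q n * N n := by
          refine sum_congr rfl fun q _ => ?_
          rw [mul_sum]
          exact sum_congr rfl fun i _ => by rw [mul_sum]
  have h2 : ∑ n ∈ R, ∑ q ∈ S, w q * ∑ i ∈ I, Z i q n =
      ∑ q ∈ S, w q * ∑ i ∈ I, ∑ n ∈ R, Z i q n := by
    calc ∑ n ∈ R, ∑ q ∈ S, w q * ∑ i ∈ I, Z i q n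
        = ∑ n ∈ R, ∑ q ∈ S, ∑ i ∈ I, w q * Z i q n := by
          refine sum_congr rfl fun n _ => sum_congr rfl fun q _ => ?_
          rw [mul_sum]
      _ = ∑ q ∈ S, ∑ n ∈ R, ∑ i ∈ I, w q * Z i q n := sum_comm
      _ = ∑ q ∈ S, ∑ i ∈ I, ∑ n ∈ R, w q * Z i q n :=
          sum_congr rfl fun q _ => sum_comm
      _ = ∑ q ∈ S, w q * ∑ i ∈ I, ∑ n ∈ R, Z i q n := by
          refine sum_congr rfl fun q _ => ?_
          rw [mul_sum]
          exact sum_congr rfl fun i _ => by rw [mul_sum]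
  rw [h1, h2, sum_div, sum_div, sum_mul, ← sum_sub_distrib]
  refine sum_congr rfl fun q _ => ?_
  have e1 : ∑ i ∈ I, ((∑ n ∈ R, Z i q n * N n) / Y - (∑ n ∈ R, Z i q n) / Y * ((∑ n ∈ R, N n) / Y)) =
      (∑ i ∈ I, ∑ n ∈ R, Z i q n * N n) / Y -
        (∑ i ∈ I, ∑ n ∈ R, Z i q n) / Y * ((∑ n ∈ R, N n) / Y) := by
    rw [sum_sub_distrib, ← sum_div, ← sum_mul, ← sum_div]
  rw [e1]
  ring

/-- Mertens' first theorem over `PP(y)`: `Σ_{q ∈ PP(y)} Λ(q)/q ≤ 2 log y + 2`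
(`Σ_{p ≤ y} log p/p ≤ log y + log 4` and `Σ_{p² ≤ y} log p/p² ≤ log y · Σ_p p⁻² ≤ log y`).
[folklore] -/
theorem sum_PP_vonMangoldt_div_le :
    ∀ (y : ℕ), ∑ q ∈ (Nat.primesLE y ∪ ((Nat.primesLE y).filter (fun p => p ^ 2 ≤ y)).image (fun p => p ^ 2)), ArithmeticFunction.vonMangoldt q / (q : ℝ) ≤ 2 * Real.log y + 2 := by
  intro y
  refine (sum_PP_le (g := fun q : ℕ => ArithmeticFunction.vonMangoldt q / (q : ℝ)) fun q =>
    div_nonneg ArithmeticFunction.vonMangoldt_nonneg (Nat.cast_nonneg _)).trans ?_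
  have h1 : ∑ p ∈ Nat.primesLE y, ArithmeticFunction.vonMangoldt p / (p : ℝ) ≤ Real.log y + 2 := by
    calc ∑ p ∈ Nat.primesLE y, ArithmeticFunction.vonMangoldt p / (p : ℝ)
        = ∑ p ∈ Nat.primesLE y, Real.log p / p :=
          sum_congr rfl fun p hp => by
            rw [ArithmeticFunction.vonMangoldt_apply_prime (Nat.mem_primesLE.1 hp).2]
      _ ≤ Real.log y + Real.log 4 :=
          Literature.NumberTheory.LFunctions.MertensBound.sum_log_div_prime_le y
      _ ≤ Real.log y + 2 := by
          have h2 : Real.log 2 ≤ 1 := by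
            have := Real.log_two_lt_d9; linarith
          have h4 : Real.log 4 = 2 * Real.log 2 := by
            rw [show (4 : ℝ) = 2 ^ 2 by norm_num, Real.log_pow]; push_cast; ring
          linarith
  have h2 : ∑ p ∈ (Nat.primesLE y).filter (fun p => p ^ 2 ≤ y),
      ArithmeticFunction.vonMangoldt (p ^ 2) / ((p ^ 2 : ℕ) : ℝ) ≤ Real.log y := by
    calc ∑ p ∈ (Nat.primesLE y).filter (fun p => p ^ 2 ≤ y),
          ArithmeticFunction.vonMangoldt (p ^ 2) / ((p ^ 2 : ℕ) : ℝ)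
        ≤ ∑ p ∈ (Nat.primesLE y).filter (fun p => p ^ 2 ≤ y), Real.log y * (1 / ((p : ℝ) ^ 2)) := by
          refine sum_le_sum fun p hp0 => ?_
          have hp := (Nat.mem_primesLE.1 (mem_filter.1 hp0).1)
          rw [ArithmeticFunction.vonMangoldt_apply_pow two_ne_zero,
            ArithmeticFunction.vonMangoldt_apply_prime hp.2]
          push_cast
          rw [div_eq_mul_one_div]
          have hple : (p : ℝ) ≤ y := by exact_mod_cast hp.1
          exact mul_le_mul_of_nonneg_right
            (Real.log_le_log (by exact_mod_cast hp.2.pos) hple) (by positivity)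
      _ = Real.log y * ∑ p ∈ (Nat.primesLE y).filter (fun p => p ^ 2 ≤ y), 1 / ((p : ℝ) ^ 2) := by
          rw [mul_sum]
      _ ≤ Real.log y * 1 := by gcongr; exact sum_primesLE_sq_inv_le_one y
      _ = Real.log y := mul_one _
  linarith

/-- The termwise inequality of the bridge: for a weight `w = 1 − 2Λ/L` with `0 ≤ Λ ≤ L`, `0 < L`,
a quantity `c` with `−(A t) ≤ c ≤ U`, `0 ≤ A t`, `0 ≤ U` and `U · (2Λ/L) ≤ B t`, one has
`w c ≥ −(A t + B t)` (for `w ≥ 0` use the lower bound, for `w < 0` the upper bound and `2Λ/L > 1`).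
[folklore] -/
theorem weightedTerm_ge {Λ L At Bt c U : ℝ} (hΛ0 : 0 ≤ Λ) (hΛL : Λ ≤ L) (hL : 0 < L)
    (hAt : 0 ≤ At) (hlow : -At ≤ c) (hup : c ≤ U) (hU0 : 0 ≤ U) (hUB : U * (2 * Λ / L) ≤ Bt) :
    -(At + Bt) ≤ (1 - 2 * Λ / L) * c := by
  have hw2 : 2 * Λ / L ≤ 2 := by rw [div_le_iff₀ hL]; linarith
  have hr0 : 0 ≤ 2 * Λ / L := by positivity
  have hBt : 0 ≤ Bt := (mul_nonneg hU0 hr0).trans hUB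
  by_cases hw : 2 * Λ ≤ L
  · -- `0 ≤ w ≤ 1`: use the lower bound `−(A t) ≤ c`
    have hw0 : 0 ≤ 1 - 2 * Λ / L := by
      rw [sub_nonneg, div_le_one hL]; exact hw
    have h1 : (1 - 2 * Λ / L) * (-At) ≤ (1 - 2 * Λ / L) * c :=
      mul_le_mul_of_nonneg_left hlow hw0
    have hprod : 0 ≤ (2 * Λ / L) * At := mul_nonneg hr0 hAt
    linarith
  · -- `−1 ≤ w < 0`: use the upper bound `c ≤ U ≤ U · (2Λ/L) ≤ B t`
    have hw' : L < 2 * Λ := not_le.1 hw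
    have hwneg : 1 - 2 * Λ / L < 0 := by
      rw [sub_neg, lt_div_iff₀ hL]; linarith
    have hr1 : 1 ≤ 2 * Λ / L := by rw [le_div_iff₀ hL]; linarith
    have hUle : U ≤ Bt := by
      have := mul_le_mul_of_nonneg_left hr1 hU0
      linarith
    have h1 : -U ≤ (1 - 2 * Λ / L) * c := by
      by_cases hc0 : 0 ≤ c
      · have : 0 ≤ (1 + (1 - 2 * Λ / L)) * c := mul_nonneg (by linarith) hc0
        linarith
      · have hc0 : c < 0 := not_le.1 hc0
        have : 0 < (1 - 2 * Λ / L) * c := mul_pos_of_neg_of_neg hwneg hc0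
        linarith
    linarith

end Summit.Parity.BatemanHorn.Cruxes.SystemMomentDeficit.Ideator3Sketch
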